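import Literature.MathematicalPhysics.QuantumFieldTheory.Balaban1983to89.T4HistoryLipschitzActivity
import Summits.QuantumFields.BalabanUV.T4Continuum.Support.NE9BirthCouplingTwoPoint

/-!
# NE9BirthCouplingJunction — route P3's BIRTH supplier (insertion at REAL coupling) delivered in the EXACT shape of the
row owner's binder `hCup` (COUPLING TWO-POINT, `Support/NE9LastCouplingBridge.norm_newTerm_sub_le_of_couplingTwoPoint` /
`lastCouplingLipschitz_of_couplingTwoPoint`, lineage t4-ne9-p1) over route P2's cluster geometry
(`T4HistoryLipschitzActivity.ClusterGeom`): for an activity family of INSERTION STRUCTURE — per step `k`, background `U`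
and polymer `γ` a block (Gaussian normalisation `A`, reference measure `μ` carrying the coupling-free cut-off, action
density `S ≥ 0` multiplied by the coupling), per configuration `Q` a coupling-free density `f` — the uniform bound of the
printed-TYPE absolute-value functional on the dilated coupling range gives `hCup` VERBATIM with `clip k = t₀⁻¹` and the
volume-weighted majorant `max(1, K(θ, n_γ))·N₀` (cell `pub-balaban`, node U3 / NE9; BINDER row NE9 co-owner #3, unit
`b2b-balaban-t4-ne9-p3`; skeleton `HOME/t4/skeletons/NE9-t4-ne9-p3.md` L4 / C7; trigger `T4-NE9-TRIGGER.json` c4: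
(L)-supplier (iv), t-currency c5)

HONEST FRAMING (T4-DAG PAGE 1).  Rung (B)+1 on a FIXED finite torus; NOT infinite volume, NOT the mass gap, NOT Clay.  NE9 is
NOT PRINTED and NOT discharged; OUR OWN WORK (Summits side), [folklore] bookkeeping over ABSTRACT carriers and the one-block
model objects of `T4ComplexDilation` / `NE9BirthCouplingTwoPoint`; nothing is asserted about Bałaban's (2.14) activities
([Balaban1988RG2Cluster] p. 15) — that they HAVE the insertion structure in the unscaled variables of [Balaban1987RG1] (2.10)
p. 267 (coupling = prefactor `1/g_k²` of the fluctuation action, cut-off (2.9) coupling-free) is the located READING of the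
skeleton's leaf L4, and the uniform majorant hypothesis `habs` is the printed TYPE of [Balaban1988RG2Cluster] Lemma 3 (2.38)
(uniform in the coupling of the window) with the volume factor to be absorbed by (2.30) — DISPLAYED, instantiation = O2.
Spine 0/9 unchanged.

WHAT IS PROVED.  `insAct` (the insertion-structured family `k t U Q γ ↦ actR (A k U γ) (μ k U γ) (f k U Q γ) (S k U γ) t`,
block dimension `nv k U γ`); **`hCup_of_insertion`**: blocks positive definite, densities integrable on the admissible
configurations, `S` measurable, nonnegative, bounded per block, window couplings `≥ t₀ > 0`, `0 < θ < 1`, and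
`absAct ≤ N₀ k U γ` for all couplings `r ≥ (1−θ)t₀` and all admissible `Q` ⇒ for all `g, g′ ∈ W`, scale-(k+1) domains `X`,
admissible `Q`, `γ ∈ vol X`:  `‖act k (g k) U Q γ‖ ≤ n k (g′ k) U γ` and `‖act k (g k) U Q γ − act k (g′ k) U Q γ‖ ≤
t₀⁻¹·|g k − g′ k|·n k (g′ k) U γ` with `n k s U γ := max 1 (K(θ, nv k U γ))·N₀ k U γ` (coupling-INDEPENDENT, as the
cross-uniformity of `hCup` wants), `K = birthConst` of `NE9BirthCouplingTwoPoint` — i.e. the `hCup` clause with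
`clip k = t₀⁻¹`.  The KP condition for `2n` (the owner's `TwoPointKP`) is NOT touched: it is where the volume factor
`max(1, K)` must be absorbed by the decay in the polymer size (displayed; (2.30) TYPE).
-/

noncomputable section

namespace Summit.QuantumFields.BalabanUV.T4Continuum.NE9BirthCouplingJunction

open MeasureTheory
open Literature.MathematicalPhysics.QuantumFieldTheory.Balaban1983to89
open Literature.MathematicalPhysics.QuantumFieldTheory.Balaban1983to89.T4OutputRate
open Literature.MathematicalPhysics.QuantumFieldTheory.Balaban1983to89.T4HistoryLipschitzActivity (ClusterGeom)
open Literature.MathematicalPhysics.QuantumFieldTheory.Balaban1983to89.T4ComplexDilation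
open Summit.QuantumFields.BalabanUV.T4Continuum.NE9BirthCouplingTwoPoint

variable {C : Carriers} (G : ClusterGeom C) {Bg : Type} {Pot : Type*} {X' : Type*} [MeasurableSpace X']

/-- The INSERTION-STRUCTURED activity family on a cluster geometry: block data `(A, μ, S)` per (step, background, polymer)
with `nv k U γ` integration variables, coupling-free density `f` per configuration `Q`, coupling `t` only in the Boltzmann
weight `e^{−tS}` and the real normalisation (the structure of [Balaban1987RG1] (2.10) p. 267 read per polymer — a READING,
see the module docstring). [folklore] -/
def insAct (nv : ℕ → Bg → G.P → ℕ) (A : (k : ℕ) → (U : Bg) → (γ : G.P) → Matrix (Fin (nv k U γ)) (Fin (nv k U γ)) ℝ)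
    (μ : ℕ → Bg → G.P → Measure X') (f : ℕ → Bg → Pot → G.P → X' → ℂ) (S : ℕ → Bg → G.P → X' → ℝ) :
    ℕ → ℝ → Bg → Pot → G.P → ℂ :=
  fun k t U Q γ => actR (A k U γ) (μ k U γ) (f k U Q γ) (S k U γ) t

/-- The volume-weighted, coupling-INDEPENDENT majorant `n k s U γ = max(1, K(θ, n_γ))·N₀ k U γ`. [folklore] -/
def insMajorant (θ : ℝ) (nv : ℕ → Bg → G.P → ℕ) (N₀ : ℕ → Bg → G.P → ℝ) : ℕ → ℝ → Bg → G.P → ℝ :=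
  fun k _ U γ => max 1 (birthConst θ (nv k U γ)) * N₀ k U γ

/-- **`hCup` FROM THE INSERTION STRUCTURE (kernel; (L)-supplier (iv) in the owner's binder shape).**  See the module
docstring for the hypotheses; the conclusion is, literally, the COUPLING TWO-POINT clause of
`NE9LastCouplingBridge.norm_newTerm_sub_le_of_couplingTwoPoint` for `act := insAct …`, `n := insMajorant θ nv N₀`,
`clip := fun _ => t₀⁻¹`, on any window whose couplings are `≥ t₀` (t-currency). [folklore] -/
theorem hCup_of_insertion {W : Set (ℕ → ℝ)} {𝒜 : ℕ → Set Pot} {t₀ θ : ℝ} (ht₀ : 0 < t₀) (hθ : 0 < θ) (hθ1 : θ < 1)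
    (hW : ∀ g ∈ W, ∀ k, t₀ ≤ g k) {nv : ℕ → Bg → G.P → ℕ}
    {A : (k : ℕ) → (U : Bg) → (γ : G.P) → Matrix (Fin (nv k U γ)) (Fin (nv k U γ)) ℝ}
    {μ : ℕ → Bg → G.P → Measure X'} {f : ℕ → Bg → Pot → G.P → X' → ℂ} {S : ℕ → Bg → G.P → X' → ℝ}
    (hA : ∀ k U γ, (A k U γ).PosDef) (hf : ∀ k U γ, ∀ Q ∈ 𝒜 k, Integrable (f k U Q γ) (μ k U γ))
    (hSm : ∀ k U γ, Measurable (S k U γ)) (hS : ∀ k U γ x, 0 ≤ S k U γ x)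
    (hS₀ : ∀ k U γ, ∃ S₀ : ℝ, ∀ x, |S k U γ x| ≤ S₀) {N₀ : ℕ → Bg → G.P → ℝ}
    (habs : ∀ k U γ, ∀ Q ∈ 𝒜 k, ∀ r, (1 - θ) * t₀ ≤ r →
      absAct (A k U γ) (μ k U γ) (f k U Q γ) (S k U γ) r ≤ N₀ k U γ) :
    ∀ g ∈ W, ∀ g' ∈ W, ∀ (k : ℕ) (U : Bg) (X : C.Dom), C.scale X = k + 1 → ∀ Q ∈ 𝒜 k, ∀ γ ∈ G.vol X,
      ‖insAct G nv A μ f S k (g k) U Q γ‖ ≤ insMajorant G θ nv N₀ k (g' k) U γ ∧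
        ‖insAct G nv A μ f S k (g k) U Q γ - insAct G nv A μ f S k (g' k) U Q γ‖ ≤
          t₀⁻¹ * |g k - g' k| * insMajorant G θ nv N₀ k (g' k) U γ := by
  intro g hg g' hg' k U X _ Q hQ γ _
  obtain ⟨S₀, hS₀'⟩ := hS₀ k U γ
  have key := couplingTwoPoint_of_insertion (A k U γ) (hA k U γ) (hf k U γ Q hQ) (hSm k U γ) (hS k U γ) hS₀' hθ hθ1
    ht₀ (habs k U γ Q hQ) (hW g hg k) (hW g' hg' k)
  obtain ⟨hsize, htwo⟩ := key
  -- `N₀ ≥ 0` (it dominates a nonnegative functional) and `1 ≤ max 1 K`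
  have hN₀ : 0 ≤ N₀ k U γ :=
    (absAct_nonneg _ _ _ _ _).trans (habs k U γ Q hQ (g k) (by nlinarith [hW g hg k]))
  have hmax1 : 1 ≤ max 1 (birthConst θ (nv k U γ)) := le_max_left _ _
  have hmaxK : birthConst θ (nv k U γ) ≤ max 1 (birthConst θ (nv k U γ)) := le_max_right _ _
  have hcard : Fintype.card (Fin (nv k U γ)) = nv k U γ := Fintype.card_fin _
  refine ⟨?_, ?_⟩
  · -- size: ‖act‖ ≤ N₀ ≤ max(1,K)·N₀
    calc ‖insAct G nv A μ f S k (g k) U Q γ‖ ≤ N₀ k U γ := hsize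
      _ = 1 * N₀ k U γ := (one_mul _).symm
      _ ≤ max 1 (birthConst θ (nv k U γ)) * N₀ k U γ := mul_le_mul_of_nonneg_right hmax1 hN₀
  · -- two-point: (K/t₀)·N₀·|Δ| ≤ t₀⁻¹·|Δ|·(max(1,K)·N₀)
    rw [hcard] at htwo
    calc ‖insAct G nv A μ f S k (g k) U Q γ - insAct G nv A μ f S k (g' k) U Q γ‖
        ≤ birthConst θ (nv k U γ) / t₀ * N₀ k U γ * |g k - g' k| := htwo
      _ ≤ max 1 (birthConst θ (nv k U γ)) / t₀ * N₀ k U γ * |g k - g' k| := by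
          have : birthConst θ (nv k U γ) / t₀ ≤ max 1 (birthConst θ (nv k U γ)) / t₀ :=
            div_le_div_of_nonneg_right hmaxK ht₀.le
          exact mul_le_mul_of_nonneg_right (mul_le_mul_of_nonneg_right this hN₀) (abs_nonneg _)
      _ = t₀⁻¹ * |g k - g' k| * (max 1 (birthConst θ (nv k U γ)) * N₀ k U γ) := by ring

/-- The majorant is coupling-independent (the cross-uniformity `hCup` asks for is automatic). [folklore] -/
theorem insMajorant_indep (θ : ℝ) (nv : ℕ → Bg → G.P → ℕ) (N₀ : ℕ → Bg → G.P → ℝ) (k : ℕ) (s s' : ℝ) (U : Bg)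
    (γ : G.P) : insMajorant G θ nv N₀ k s U γ = insMajorant G θ nv N₀ k s' U γ := rfl

end Summit.QuantumFields.BalabanUV.T4Continuum.NE9BirthCouplingJunction

end
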